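import Summits.MatrixMultiplication.OmegaCensus.STPPVosperSlackTwoCheckers

/-!
# ω-census (abelian STPP census): slack-2 case-A ROWS for `{(3,3,3),(3,3,4)} @ ℤ₆₁`, part 2 (kernel `decide`)

HONEST FRAMING (pub-omega census; verbatim): lottery ticket; floor = certified bounds/negative ranges.
Census STRUCTURE (seat pub-omega-stpp-1 gen 32, 2026-08-28), family (b2).  Rows of the slack-2 partition law (`slack_two_caseC_of_rows`,
`STPPVosperSlackTwoLawAB.lean`) for the leaf `{(3,3,3),(3,3,4)}` of `ℤ/61` in the reading block `i = (4,3,3)`, other block `(3,3,3)` (`L = z = 9`):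
case A, three-element free shapes `Q ∋ 0` numbers `lo ≤ · < hi` of the enumeration `qShapes 61 3` (1 770 in all; 36 chunks of 50, six per file):
`caseADeadQ 61 4 3 9 9 3 3 3 Q = true` for every `Q` in the chunk — each chunk one `decide +kernel` (≈ 30–45 s; python ×1 and Lean `#eval` statistics
of the whole case: 35 856 placements / 72 / 1 206 configurations / 54 realisations / 0 families, HOME `pub-omega-stpp-1-g32/SLACK2-DESIGN.md`).
COMPUTATIONAL (`decide +kernel`).  Nothing here is progress on `ω`.

References: H. Cohn, R. Kleinberg, B. Szegedy, C. Umans, FOCS 2005 (arXiv:math/0511460), Def. 5.1.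
-/

namespace Summit.MatrixMultiplication.OmegaCensus.CubeNB.S2

/-- Case-A row, shapes `300 ≤ · < 350`: every configuration is dead. [cite: CohnKleinbergSzegedyUmans2005, Def. 5.1] -/
theorem rowA333_300_350 : ((qShapes 61 3 300 350).all fun Q => caseADeadQ 61 4 3 9 9 3 3 3 Q) = true := by
  decide +kernel

/-- Case-A row, shapes `350 ≤ · < 400`: every configuration is dead. [cite: CohnKleinbergSzegedyUmans2005, Def. 5.1] -/
theorem rowA333_350_400 : ((qShapes 61 3 350 400).all fun Q => caseADeadQ 61 4 3 9 9 3 3 3 Q) = true := by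
  decide +kernel

/-- Case-A row, shapes `400 ≤ · < 450`: every configuration is dead. [cite: CohnKleinbergSzegedyUmans2005, Def. 5.1] -/
theorem rowA333_400_450 : ((qShapes 61 3 400 450).all fun Q => caseADeadQ 61 4 3 9 9 3 3 3 Q) = true := by
  decide +kernel

/-- Case-A row, shapes `450 ≤ · < 500`: every configuration is dead. [cite: CohnKleinbergSzegedyUmans2005, Def. 5.1] -/
theorem rowA333_450_500 : ((qShapes 61 3 450 500).all fun Q => caseADeadQ 61 4 3 9 9 3 3 3 Q) = true := by
  decide +kernel

/-- Case-A row, shapes `500 ≤ · < 550`: every configuration is dead. [cite: CohnKleinbergSzegedyUmans2005, Def. 5.1] -/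
theorem rowA333_500_550 : ((qShapes 61 3 500 550).all fun Q => caseADeadQ 61 4 3 9 9 3 3 3 Q) = true := by
  decide +kernel

/-- Case-A row, shapes `550 ≤ · < 600`: every configuration is dead. [cite: CohnKleinbergSzegedyUmans2005, Def. 5.1] -/
theorem rowA333_550_600 : ((qShapes 61 3 550 600).all fun Q => caseADeadQ 61 4 3 9 9 3 3 3 Q) = true := by
  decide +kernel

end Summit.MatrixMultiplication.OmegaCensus.CubeNB.S2
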